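import Mathlib
import HarnessLib
import Summits.ValiantsHypothesis.ValiantsHypothesis.Theorems.MonotoneRestorationOrbitRestorationQPInjectivePlacements

/-!
# INJ (both sides): injective row AND column placements of a local affine form are narrow, treewidth `≤ r + c + 1`

Route MonotoneRestoration, crux `OrbitRestorationQP` (stmt-ValiantsHypothesis-18293), SPAN-currency lane of the open
sub-rung A_∞ (`stub_sigmaPiSigmaValue`); evidence note `SPAN-CURRENCY-A1-g7g4.md` §5.  Helper (`--supports`), def-free.
Completes lemma INJ of the untwisted `ΠΣ` programme: with `…InjectivePlacements.lean` (row side) as the base, the same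
inclusion–exclusion is run on the column pairs.

* `exists_quotientMap_of_pairs` — placements `Fin m → Fin n` constant on a set of pairs are exactly the compositions
  `g ∘ π` for a surjection `π : Fin m ↠ Fin m'` (connected components of the constraint graph), `m' ≤ m`, uniformly in `n`;
* `localForm_comp_col_eq_merged` — placing along `g ∘ π` on the COLUMN side = placing the column-merged datum;
* **`sum_injective_injective_pow_affineLocalForm_mem_narrowSpan`** — INJ:
  `Σ_{φ inj} Σ_{ψ inj} (β₀ + δU + Σ α x_{φa,ψb} + Σ β R_{φa} + Σ γ C_{ψb})^k ∈ span_ℂ {hom_{F,n} : tw F ≤ r + c + 1}`.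

What remains for the general untwisted `ΠΣ` theorem in span currency: the assembly from
`LocalFactors.exists_rowColSupports_of_matrixSymmetric` (structure of the factors), the untwisted normalisation of a
line-orbit (note §2 Step 2), the identification orbit = injective placements / stabiliser, and `NarrowSpanNewton`.
Honest label: infrastructure; no stub closed; VP ≠ VNP untouched.
-/

noncomputable section

-- `Summit.ValiantsHypothesis.ValiantsHypothesis.…` is the tree's single-conjunct layout (Sub = Summit).
set_option linter.dupNamespace false

namespace Summit.ValiantsHypothesis.ValiantsHypothesis.Theorems

namespace CorePatterns

open MvPolynomial Finset
open Literature.Computability.AlgebraicComplexity (homPoly)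
open Literature.Combinatorics.SimpleGraph (treewidth)

/-- **Placements constant on a set of pairs are the compositions with a quotient map** (the connected components of
the constraint graph), uniformly in the target. [folklore] -/
theorem exists_quotientMap_of_pairs (m : ℕ) (S : Finset (Fin m × Fin m)) (hS : ∀ p ∈ S, p.1 ≠ p.2) :
    ∃ (m' : ℕ) (π : Fin m → Fin m'), m' ≤ m ∧ Function.Surjective π ∧
      ∀ n : ℕ, (univ : Finset (Fin m → Fin n)).filter (fun φ => ∀ p ∈ S, φ p.1 = φ p.2) =
        (univ : Finset (Fin m' → Fin n)).image (fun g => g ∘ π) := by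
  classical
  set G : SimpleGraph (Fin m) := SimpleGraph.fromRel fun a a' => (a, a') ∈ S with hGdef
  set m' : ℕ := Fintype.card G.ConnectedComponent with hm'
  set e : G.ConnectedComponent ≃ Fin m' := Fintype.equivFin G.ConnectedComponent with he
  set π : Fin m → Fin m' := fun a => e (G.connectedComponentMk a) with hπ
  have hπsurj : Function.Surjective π := by
    intro i
    obtain ⟨a, ha⟩ := Quot.exists_rep (e.symm i)
    refine ⟨a, ?_⟩
    simp only [hπ]
    rw [show G.connectedComponentMk a = e.symm i from ha, Equiv.apply_symm_apply]
  have hm'le : m' ≤ m := by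
    have := Fintype.card_le_of_surjective π hπsurj
    simpa using this
  refine ⟨m', π, hm'le, hπsurj, fun n => ?_⟩
  have hconst : ∀ φ : Fin m → Fin n, (∀ p ∈ S, φ p.1 = φ p.2) →
      ∀ v w : Fin m, G.Reachable v w → φ v = φ w := by
    intro φ hφ v w hvw
    rw [SimpleGraph.reachable_iff_reflTransGen] at hvw
    induction hvw with
    | refl => rfl
    | tail _ hadj ih =>
      rw [ih]
      rw [hGdef, SimpleGraph.fromRel_adj] at hadj
      rcases hadj.2 with h | h
      · exact hφ _ h
      · exact (hφ _ h).symm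
  ext φ
  simp only [Finset.mem_filter, Finset.mem_univ, true_and, Finset.mem_image]
  constructor
  · intro hφ
    refine ⟨(SimpleGraph.ConnectedComponent.lift φ fun v w p _ => hconst φ hφ v w p.reachable) ∘ e.symm, ?_⟩
    funext a
    simp [hπ]
  · rintro ⟨g, rfl⟩ p hp
    simp only [Function.comp_apply, hπ]
    rw [SimpleGraph.ConnectedComponent.connectedComponentMk_eq_of_adj]
    rw [hGdef, SimpleGraph.fromRel_adj]
    exact ⟨hS p hp, Or.inl (by simpa using hp)⟩

/-- **Placing along `g ∘ π` on the column side = placing the column-merged datum along `g`.** [folklore] -/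
theorem localForm_comp_col_eq_merged (n r c c' : ℕ) (β₀ δ : ℂ) (α : Fin r × Fin c → ℂ) (β : Fin r → ℂ)
    (γ : Fin c → ℂ) (π : Fin c → Fin c') (φ : Fin r → Fin n) (g : Fin c' → Fin n) :
    (C β₀ + C δ * ∑ i : Fin n, ∑ j : Fin n, (X (i, j) : MvPolynomial (Fin n × Fin n) ℂ)) +
        ((∑ ab : Fin r × Fin c, C (α ab) * (X (φ ab.1, g (π ab.2)) : MvPolynomial (Fin n × Fin n) ℂ)) +
          (∑ a : Fin r, C (β a) * ∑ j : Fin n, (X (φ a, j) : MvPolynomial (Fin n × Fin n) ℂ)) +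
          (∑ b : Fin c, C (γ b) * ∑ j : Fin n, (X (j, g (π b)) : MvPolynomial (Fin n × Fin n) ℂ))) =
    (C β₀ + C δ * ∑ i : Fin n, ∑ j : Fin n, (X (i, j) : MvPolynomial (Fin n × Fin n) ℂ)) +
        ((∑ aj : Fin r × Fin c', C (∑ b ∈ (univ : Finset (Fin c)).filter (fun b => π b = aj.2), α (aj.1, b)) *
            (X (φ aj.1, g aj.2) : MvPolynomial (Fin n × Fin n) ℂ)) +
          (∑ a : Fin r, C (β a) * ∑ j : Fin n, (X (φ a, j) : MvPolynomial (Fin n × Fin n) ℂ)) +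
          (∑ j : Fin c', C (∑ b ∈ (univ : Finset (Fin c)).filter (fun b => π b = j), γ b) *
            ∑ i : Fin n, (X (i, g j) : MvPolynomial (Fin n × Fin n) ℂ))) := by
  congr 2
  · congr 1
    -- cells
    rw [Fintype.sum_prod_type, Fintype.sum_prod_type]
    refine Finset.sum_congr rfl fun a _ => ?_
    symm
    simp_rw [map_sum, Finset.sum_mul]
    rw [← Finset.sum_fiberwise (univ : Finset (Fin c)) π
      (fun b => C (α (a, b)) * (X (φ a, g (π b)) : MvPolynomial (Fin n × Fin n) ℂ))]
    refine Finset.sum_congr rfl fun j _ => Finset.sum_congr rfl fun b hb => ?_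
    rw [(Finset.mem_filter.1 hb).2]
  · -- column pendants
    symm
    simp_rw [map_sum, Finset.sum_mul]
    rw [← Finset.sum_fiberwise (univ : Finset (Fin c)) π
      (fun b => C (γ b) * ∑ i : Fin n, (X (i, g (π b)) : MvPolynomial (Fin n × Fin n) ℂ))]
    refine Finset.sum_congr rfl fun j _ => Finset.sum_congr rfl fun b hb => ?_
    rw [(Finset.mem_filter.1 hb).2]

/-- **INJ (both sides).**  The sum over INJECTIVE row placements and INJECTIVE column placements of the `k`-th powers
of a local affine form lies in `span_ℂ {hom_{F,n} : tw F ≤ r + c + 1}`. [folklore; cite: DwivediPagoSeppelt2026, §8] -/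
theorem sum_injective_injective_pow_affineLocalForm_mem_narrowSpan (n r c k : ℕ) (β₀ δ : ℂ)
    (α : Fin r × Fin c → ℂ) (β : Fin r → ℂ) (γ : Fin c → ℂ) :
    (∑ φ ∈ (univ : Finset (Fin r → Fin n)).filter (fun φ => Function.Injective φ),
      ∑ ψ ∈ (univ : Finset (Fin c → Fin n)).filter (fun ψ => Function.Injective ψ),
      ((C β₀ + C δ * ∑ i : Fin n, ∑ j : Fin n, (X (i, j) : MvPolynomial (Fin n × Fin n) ℂ)) +
        ((∑ ab : Fin r × Fin c, C (α ab) * (X (φ ab.1, ψ ab.2) : MvPolynomial (Fin n × Fin n) ℂ)) +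
          (∑ a : Fin r, C (β a) * ∑ j : Fin n, (X (φ a, j) : MvPolynomial (Fin n × Fin n) ℂ)) +
          (∑ b : Fin c, C (γ b) * ∑ j : Fin n, (X (j, ψ b) : MvPolynomial (Fin n × Fin n) ℂ)))) ^ k) ∈
    Submodule.span ℂ {p : MvPolynomial (Fin n × Fin n) ℂ |
        ∃ (a b : ℕ) (E : Multiset (Fin a × Fin b)),
          treewidth (SimpleGraph.fromRel fun u v : Fin a ⊕ Fin b =>
            ∃ e ∈ E, u = Sum.inl e.1 ∧ v = Sum.inr e.2) ≤ r + c + 1 ∧ p = homPoly E n ℂ} := by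
  classical
  -- put the column placements outside and run inclusion–exclusion on the column pairs
  rw [Finset.sum_comm, sum_filter_injective_eq_sum_powerset]
  refine Submodule.sum_mem _ fun T hT => zsmul_mem ?_ _
  have hT' : ∀ p ∈ T, p.1 ≠ p.2 := fun p hp => ne_of_lt (Finset.mem_filter.1 (Finset.mem_powerset.1 hT hp)).2
  obtain ⟨c', π, hc'le, hπsurj, himage⟩ := exists_quotientMap_of_pairs c T hT'
  have hinj : Set.InjOn (fun g : Fin c' → Fin n => g ∘ π) ↑(univ : Finset (Fin c' → Fin n)) :=
    fun g _ g' _ h => hπsurj.injective_comp_right h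
  rw [himage n, Finset.sum_image hinj, Finset.sum_comm]
  simp_rw [Function.comp_apply]
  have hmerge := fun (φ : Fin r → Fin n) (g : Fin c' → Fin n) =>
    localForm_comp_col_eq_merged n r c c' β₀ δ α β γ π φ g
  simp_rw [hmerge]
  have hmono : Submodule.span ℂ {p : MvPolynomial (Fin n × Fin n) ℂ |
        ∃ (a b : ℕ) (E : Multiset (Fin a × Fin b)),
          treewidth (SimpleGraph.fromRel fun u v : Fin a ⊕ Fin b =>
            ∃ e ∈ E, u = Sum.inl e.1 ∧ v = Sum.inr e.2) ≤ r + c' + 1 ∧ p = homPoly E n ℂ} ≤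
      Submodule.span ℂ {p : MvPolynomial (Fin n × Fin n) ℂ |
        ∃ (a b : ℕ) (E : Multiset (Fin a × Fin b)),
          treewidth (SimpleGraph.fromRel fun u v : Fin a ⊕ Fin b =>
            ∃ e ∈ E, u = Sum.inl e.1 ∧ v = Sum.inr e.2) ≤ r + c + 1 ∧ p = homPoly E n ℂ} := by
    refine Submodule.span_mono ?_
    rintro p ⟨a, b, E, hE, rfl⟩
    exact ⟨a, b, E, hE.trans (by omega), rfl⟩
  exact hmono (sum_injective_placements_pow_affineLocalForm_mem_narrowSpan n r c' k β₀ δ _ β _)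

end CorePatterns

end Summit.ValiantsHypothesis.ValiantsHypothesis.Theorems

end
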